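import Summits.QuantumFields.YangMills.Theorems.BalabanUVNodesN10AtRecord
import Summits.QuantumFields.YangMills.Theorems.BalabanUVNodesN08AtRecord11Sides
import Literature.MathematicalPhysics.QuantumFieldTheory.Balaban1983to89.Node00.Record11Carriers
import Literature.MathematicalPhysics.QuantumFieldTheory.Balaban1983to89.B13NodeTorusTermwise

/-!
# BalabanUVNodes ∕ N10 RE-KEYED AT STAGE 11 — [Balaban1988RG2Cluster] Lemmas 1–3 (`Dag.B13_main`) at NODE 00's record predicate of record
# `Node00.IsRecordOfRecord₁₁C` (`Node00/Record11`, p444286), THE B13 GROUP RE-BOUND: Lemmas 1–2 knit at the re-bound group, Lemma 3 carried as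
# the located FLAG hypothesis (Track A, DAG node N10 [B13]; strategy s2 «by-name knit ∕ reduction at the ₁₁ record»; seat `pub-ymgap-dag-n10-d`)

HONEST FRAMING.  Count-neutral kernel bookkeeping over LANDED modules; N10 is NOT discharged; nothing of Bałaban's is asserted; no node count moves.
What a discharge still needs is displayed, not papered over: (P) the B13 PIN OBJECT — NODE 00's `CarriersB13` (the two-scale torus step datum of
record built from the term tower; not in the tree), which instantiates the GENERIC re-binding of this file by unification; (A) NODE A's content =
Lemma 3 ∕ (2.38), carried here as ONE named hypothesis per run (`h3 : B13.Lemma3Printed …`, resp. `h238 : B13.Bound238 …`); (B) the located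
per-term inputs of Lemmas 1–2, which enter through the CONCLUSION of `B13NodeTorusTermwise.lemma12_twoTorus` (p411918) by name.  Over the plain
₁₁C record class NO ∀-form of N10 is claimed (the B13 group is residual free data there — dag-p2's `…N10RecordCensus` swap test).  One finite
four-torus programme at fixed ε per run; nothing continuum ∕ ℝ⁴ ∕ OS ∕ mass-gap ∕ Clay.  0 `sorry`, 0 `def`, standard axioms.  Filed `--supports`
K1 «StabilityBAtRecordR11e» (stmt-QuantumFields-19674) of route «BalabanUVNodes» (director-ym LINE №68).

THE NODE AND THE RECORD.  `Dag.B13_main ℓ := ℓ.b9 → ℓ.b10 → ℓ.b11 → ℓ.b12 → ℓ.b13`, `b13` = the B13 triple read at the run's B13 group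
`((θ.res.X P).S13, (θ.res.X P).c13)`.  A Stage-11 record binds every run to the C-binding of record over the VIEW `θ.toStage5₁₁` (a `Stage5Params`) whose
carrier bundle `res.X` is θ's own — FREE data the datum, the provisos and admissibility never read (`Node00.datumOfRecord₁₁_rebindX`, dag-n08-c's
`N08AtRecord11Sides.provisos₁₁_rebindX` ∕ `admissible_rebindX_iff`, REUSED by name).  Hence ANY re-binding `θ.rebindX X′` of a ₁₁C record's carrier bundle gives, at the re-bound world, a
₁₁C record WITH THE SAME DATUM (§2) — NODE 00's own device (`Record11Carriers`, KERNEL LESSON 7).  The B13 pin is the instance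
`X′ P := { θ.res.X P with S13 := S P, c13 := c }` (step data `S P` per run, ONE constants record `c`; the torus chain supplies `S P := (Wt P).toStepData`),
at which the C-binding of record IS the unpinned one with `b13 :=` the triple of `(S P, c)` (§1: ONE `rfl` at a GENERIC bundle, instantiated at the view).

WHAT THIS FILE PROVES.  §1 at a re-bound Stage-5 view `φ.rebindX X′` (dag-p2's `B13NodeKnitRecord5C` faces BY NAME): `b13_leaf_iff_rebindX`,
`inEdges_iff_rebindX`, `b13_main_iff_rebindX`, `b13_main_rebindX_of_leaf`; at the literal S13∕c13 update: `ofPrintedAllXPNC_rebindS13`,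
`upOfRecord₅C_rebindS13`, `leavesP_rebindS13_eq` (the 22-leaf assignment of the re-bound world IS the old one with `b13 :=` the triple).  §2 Stage 11:
`isRecordOfRecord₁₁C_rebindX`, `exists_rebindX_of_isRecordOfRecord₁₁C` (SAME datum; the re-binding may depend on the record's parameters).  §3 N10 at the B13-re-bound Stage-11 world: `b13_main_at_stage11_rebindS13` (from the triple), `…_of_lemma12`
(Lemmas 1–2 ∧ the FLAG `h3`), `…_twoTorus` ∕ `…_twoTorus_of_238` (torus pin; Lemma 3 in the `Lemma3Printed` ∕ (2.38) currencies),
**`…_twoTorus_located`** (Lemmas 1–2 FROM THEIR LOCATED PER-TERM INPUTS through `B13NodeTorusTermwise.lemma12_twoTorus`, Lemma 3 the FLAG),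
`exists_b13World_of_isRecordOfRecord₁₁C` (K1-facing ∃-form: SAME D, C, γ, L; leaves off `b13` unchanged).  §4 `s_N10_of_boundAtRebindS13`
— `YMDAG.UVSplit.S_N10 Rec` for EVERY record predicate whose worlds are bound at a B13-re-bound Stage-11 view carrying the triple (what `CarriersB13`'s
record instantiates).
-/

noncomputable section

namespace Summit.QuantumFields.YangMills.BalabanUVNodes.N10AtRecord11

open Literature.MathematicalPhysics.QuantumFieldTheory.Balaban1983to89
open Literature.MathematicalPhysics.QuantumFieldTheory.Balaban1983to89.T4Continuum
open Literature.MathematicalPhysics.QuantumFieldTheory.Balaban1983to89.DagBinding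
open Literature.MathematicalPhysics.QuantumFieldTheory.Balaban1983to89.Node00
open Literature.MathematicalPhysics.QuantumFieldTheory.Balaban1983to89.B13Lemma3Torus (TwoTorusStep)
open Literature.MathematicalPhysics.QuantumFieldTheory.Balaban1983to89.B13NodeKnitRecord5C
  (b13_leaf_iff_res₅C inEdges_iff_res₅C b13_main_iff_res₅C)
open YMDAG.UVSplit (RecordPred AtRecord S_N10)
open Summit.QuantumFields.YangMills.BalabanUVNodes.N08AtRecord11Sides (provisos₁₁_rebindX admissible_rebindX_iff)

variable (F : T4Family) (N : ℕ) [NeZero N]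

/-! ## §1. The C-binding at a re-bound Stage-5 view: `b13` and the in-edges read the new bundle, every other leaf is unchanged -/

section Stage5

variable (φ : Stage5Params F N) (X' : B12.RunParams → PrintedCarriersR) (w : WorldP) (P : B12.RunParams)

/-- **Leaf `b13` at a run bound to the C-binding of a re-bound view**: the B13 triple of `((X′ P).S13, (X′ P).c13)` (dag-p2's
`b13_leaf_iff_res₅C` at `φ.rebindX X′`). [cite: Balaban1988RG2Cluster, Lemma 1 p.9, Lemma 2 p.11, Lemma 3 p.20 (dictionary, bookkeeping)] -/
theorem b13_leaf_iff_rebindX (hup : w.up P = upOfRecord₅C F N (φ.rebindX F N X') P) :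
    (leavesP w P).b13 ↔
      B13.Lemma1Printed (X' P).S13 (X' P).c13 ∧ B13.Lemma2Printed (X' P).S13 (X' P).c13 ∧
        B13.Lemma3Printed (X' P).S13 (X' P).c13 :=
  b13_leaf_iff_res₅C F N (φ.rebindX F N X') w P hup

/-- **The in-edges of N10 at a run bound to the C-binding of a re-bound view**: `b9`, `b11` read the view's UNCHANGED [B9] ∕ [B11] carriers, `b10`,
`b12` read the new bundle's [B10] ∕ [B12] groups (dag-p2's `inEdges_iff_res₅C` at `φ.rebindX X′`).
[cite: Balaban1988RG2Cluster, p.1 (references [13], [15], [16], [I]; dictionary, bookkeeping)] -/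
theorem inEdges_iff_rebindX (hup : w.up P = upOfRecord₅C F N (φ.rebindX F N X') P) :
    ((leavesP w P).b9 ↔ B9LeafX (φ.res.Y P)) ∧
    ((leavesP w P).b10 ↔ B10.Thm1PrintedCompact (X' P).runs10 ∧ B10.Thm2Printed (X' P).runs10) ∧
    ((leavesP w P).b11 ↔ B11Leaf (φ.res.Z P)) ∧
    ((leavesP w P).b12 ↔ B12Sec2to5.Lemma4Printed (X' P).F12 (X' P).c12) :=
  inEdges_iff_res₅C F N (φ.rebindX F N X') w P hup

/-- **N10 unfolded at a re-bound view** (`Iff.rfl` by name): in-edges at the view's [B9] ∕ [B11] carriers and the new bundle's [B10] ∕ [B12] groups ⇒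
the B13 triple of the new bundle's B13 group. [cite: Balaban1988RG2Cluster, Lemmas 1–3 pp.9, 11, 20; p.1 (in-edges)] -/
theorem b13_main_iff_rebindX (hup : w.up P = upOfRecord₅C F N (φ.rebindX F N X') P) :
    Dag.B13_main (leavesP w P) ↔
      (B9LeafX (φ.res.Y P) → (B10.Thm1PrintedCompact (X' P).runs10 ∧ B10.Thm2Printed (X' P).runs10) →
        B11Leaf (φ.res.Z P) → B12Sec2to5.Lemma4Printed (X' P).F12 (X' P).c12 →
          B13.Lemma1Printed (X' P).S13 (X' P).c13 ∧ B13.Lemma2Printed (X' P).S13 (X' P).c13 ∧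
            B13.Lemma3Printed (X' P).S13 (X' P).c13) :=
  b13_main_iff_res₅C F N (φ.rebindX F N X') w P hup

/-- N10 at a run bound to a re-bound view FROM THE LEAF TRIPLE of the new B13 group (in-edges unused, as in every torus knit of the lineage).
[cite: Balaban1988RG2Cluster, Lemmas 1–3 pp.9, 11, 20 (bookkeeping)] -/
theorem b13_main_rebindX_of_leaf (hup : w.up P = upOfRecord₅C F N (φ.rebindX F N X') P)
    (h : B13.Lemma1Printed (X' P).S13 (X' P).c13 ∧ B13.Lemma2Printed (X' P).S13 (X' P).c13 ∧
      B13.Lemma3Printed (X' P).S13 (X' P).c13) :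
    Dag.B13_main (leavesP w P) :=
  (b13_main_iff_rebindX F N φ X' w P hup).mpr fun _ _ _ _ => h

end Stage5

/-! ### The literal B13 update `X′ P := { φ.res.X P with S13 := S P, c13 := c }`: every other leaf of the C-binding is the unpinned one -/

section RebindS13

open B10CompactBinding (ofPrintedAllXPNC)

/-- **THE C-BINDING OVER A B13-UPDATED CARRIER BUNDLE IS THE OLD ONE WITH `b13 :=` THE TRIPLE** (generic Stage-3 dictionary `θ₃` and bundle `X`; `rfl`):
the Stage 1–3 substitutions `carriers₃` touch the B4–B7 groups only (`Node00.CarriersFrame.carriers₁_groupB13`) and every leaf but `b13` reads fields the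
update keeps.  (Stated at a GENERIC bundle the kernel check is immediate — KERNEL LESSON 7; the pinned-view instances below follow by `upOfRecord₅C_eq`.)
[cite: Balaban1988RG2Cluster, Lemmas 1–3 pp.9, 11, 20 (bookkeeping: what a B13 pin changes in the leaf assignment)] -/
theorem ofPrintedAllXPNC_rebindS13 (θ₃ : Stage3Params) (X : PrintedCarriersR) (Y : PrintedCarriers9X) (Z : PrintedCarriers11)
    (V : PrintedCarriers14R) (W : PrintedCarriers15) (s : B13.StepData) (c : B13.Consts) :
    ofPrintedAllXPNC (carriers₃ θ₃ { X with S13 := s, c13 := c }) Y Z V W =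
      { ofPrintedAllXPNC (carriers₃ θ₃ X) Y Z V W with b13 := B13.Lemma1Printed s c ∧ B13.Lemma2Printed s c ∧ B13.Lemma3Printed s c } :=
  rfl

variable (φ : Stage5Params F N) (S : B12.RunParams → B13.StepData) (c : B13.Consts) (P : B12.RunParams)

/-- **The C-binding of record at the B13-re-bound view `φ.rebindX (fun P => { φ.res.X P with S13 := S P, c13 := c })` IS the one at `φ` with `b13 :=` the
triple of `(S P, c)`** — every other upstream leaf (`b4`–`b12`, the two 𝐑-leaves) is unchanged. [cite: Balaban1988RG2Cluster, Lemmas 1–3 pp.9, 11, 20 (bookkeeping)] -/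
theorem upOfRecord₅C_rebindS13 :
    upOfRecord₅C F N (φ.rebindX F N fun P => { φ.res.X P with S13 := S P, c13 := c }) P =
      { upOfRecord₅C F N φ P with b13 := B13.Lemma1Printed (S P) c ∧ B13.Lemma2Printed (S P) c ∧ B13.Lemma3Printed (S P) c } := by
  rw [upOfRecord₅C_eq, upOfRecord₅C_eq]
  exact ofPrintedAllXPNC_rebindS13 φ.toStage3Params (φ.res.X P) (φ.res.Y P) (φ.res.Z P) (φ.res.V P) (φ.res.W P) (S P) c

/-- **THE 22-LEAF ASSIGNMENT OF THE B13-RE-BOUND WORLD IS THE OLD ONE WITH `b13 :=` THE TRIPLE**: for a world `w` bound at the view `φ` and its re-binding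
`{ w with up := upOfRecord₅C (φ.rebindX …) }` at the literal S13∕c13 update — every construction-side leaf and every upstream leaf but `b13` agree, so every
OTHER node statement transfers verbatim. [cite: Balaban1988RG2Cluster, Lemmas 1–3 pp.9, 11, 20 (bookkeeping: what a B13 pin changes in the DAG's leaf assignment)] -/
theorem leavesP_rebindS13_eq (w : WorldP) (hup : ∀ P, w.up P = upOfRecord₅C F N φ P) :
    leavesP { w with up := fun P => upOfRecord₅C F N (φ.rebindX F N fun P => { φ.res.X P with S13 := S P, c13 := c }) P } P =
      { leavesP w P with b13 := B13.Lemma1Printed (S P) c ∧ B13.Lemma2Printed (S P) c ∧ B13.Lemma3Printed (S P) c } := by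
  unfold leavesP
  simp only [hup P, upOfRecord₅C_rebindS13]

end RebindS13

/-! ## §2. Stage 11: any carrier re-binding of a ₁₁C record's parameters keeps provisos, admissibility (dag-n08-c's lemmas) and the datum; the re-bound world is a ₁₁C record -/

section Stage11

variable {F N}

variable (F N) in
/-- **Pointed form: a world bound at the C-binding over a RE-BOUND Stage-11 view is a Stage-11 record AT THE SAME DATUM** (witness `θ.rebindX X′`; datum by
`Node00.datumOfRecord₁₁_rebindX`, view by `Stage11Params.toStage5₁₁_rebindX`). [cite: Balaban1989LargeFieldII, Thm 1 + (0.1) pp.355–356 (bookkeeping)] -/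
theorem isRecordOfRecord₁₁C_rebindX (θ : Stage11Params F N) (h : θ.Provisos₁₁) (hθ : θ.Admissible)
    (X' : B12.RunParams → PrintedCarriersR) (w : WorldP) (hC : w.C = (datumOfRecord₁₁ F N θ h).C) (hγ : 0 < w.γ ∧ w.γ ≤ θ.γ)
    (hL : w.L = (θ.L : ℝ)) (hup : ∀ P, w.up P = upOfRecord₅C F N ((θ.toStage5₁₁ F N).rebindX F N X') P) :
    IsRecordOfRecord₁₁C F N (datumOfRecord₁₁ F N θ h) w := by
  refine ⟨θ.rebindX F N X', provisos₁₁_rebindX h X', (admissible_rebindX_iff θ X').2 hθ, ?_, hC, hγ, hL, fun P => ?_⟩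
  · exact (datumOfRecord₁₁_rebindX F N θ h X' (provisos₁₁_rebindX h X')).symm
  · rw [hup P, Stage11Params.toStage5₁₁_rebindX]

/-- **RECORD LEVEL: re-binding the carrier bundle of a ₁₁C record's world gives a ₁₁C record WITH THE SAME DATUM** — for ANY re-binding, even one chosen
from the record's own parameters (`X″ θ`, e.g. the B13 update of `θ.res.X`).  The record's parameters, provisos and binding are exhibited alongside.
[cite: Balaban1989LargeFieldII, Thm 1 + (0.1) pp.355–356 (bookkeeping)] -/
theorem exists_rebindX_of_isRecordOfRecord₁₁C {D : FiniteEpsData F (SU N)} {w : WorldP} (hR : IsRecordOfRecord₁₁C F N D w)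
    (X'' : Stage11Params F N → B12.RunParams → PrintedCarriersR) :
    ∃ (θ : Stage11Params F N) (hP : θ.Provisos₁₁), θ.Admissible ∧ D = datumOfRecord₁₁ F N θ hP ∧
      (∀ P, w.up P = upOfRecord₅C F N (θ.toStage5₁₁ F N) P) ∧
        IsRecordOfRecord₁₁C F N D { w with up := fun P => upOfRecord₅C F N ((θ.toStage5₁₁ F N).rebindX F N (X'' θ)) P } := by
  obtain ⟨θ, hP, hθ, hD, hC, hγ, hL, hup⟩ := hR
  refine ⟨θ, hP, hθ, hD, hup, ?_⟩
  rw [hD]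
  exact isRecordOfRecord₁₁C_rebindX F N θ hP hθ (X'' θ) _ (by rw [← hD]; exact hC) hγ hL fun _ => rfl

end Stage11

/-! ## §3. N10 at the B13-re-bound Stage-11 world: from the triple; from Lemmas 1–2 with Lemma 3 as the FLAG hypothesis; on the torus; at the record -/

section N10

variable (θ : Stage11Params F N) (S : B12.RunParams → B13.StepData) (c : B13.Consts) (w : WorldP) (P : B12.RunParams)

/-- **N10 at a run bound to the B13-re-bound Stage-11 view, from the leaf triple** of the pinned group `(S P, c)`.
[cite: Balaban1988RG2Cluster, Lemmas 1–3 pp.9, 11, 20] -/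
theorem b13_main_at_stage11_rebindS13
    (hup : w.up P = upOfRecord₅C F N ((θ.toStage5₁₁ F N).rebindX F N fun P => { θ.res.X P with S13 := S P, c13 := c }) P)
    (h : B13.Lemma1Printed (S P) c ∧ B13.Lemma2Printed (S P) c ∧ B13.Lemma3Printed (S P) c) :
    Dag.B13_main (leavesP w P) :=
  b13_main_rebindX_of_leaf F N (θ.toStage5₁₁ F N) _ w P hup h

/-- **N10 AT THE B13-RE-BOUND STAGE-11 VIEW: LEMMAS 1–2 KNIT, LEMMA 3 CARRIED AS THE LOCATED FLAG HYPOTHESIS.**  Lemmas 1–2 for the pinned step data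
(`h12` — on the two-scale torus the CONCLUSION of `B13NodeTorusTermwise.lemma12_twoTorus` from the located per-term inputs of pp. 7–11) and Lemma 3
(`h3` — p. 20: *"Under all the above restrictions … the activity H(Z) … satisfies the inequality (2.38)"*; NODE A's content, displayed, NOT proved here)
give the node at the run. [cite: Balaban1988RG2Cluster, Lemma 1 p.9, Lemma 2 p.11, Lemma 3 p.20] -/
theorem b13_main_at_stage11_of_lemma12
    (hup : w.up P = upOfRecord₅C F N ((θ.toStage5₁₁ F N).rebindX F N fun P => { θ.res.X P with S13 := S P, c13 := c }) P)
    (h12 : B13.Lemma1Printed (S P) c ∧ B13.Lemma2Printed (S P) c) (h3 : B13.Lemma3Printed (S P) c) :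
    Dag.B13_main (leavesP w P) :=
  b13_main_at_stage11_rebindS13 F N θ S c w P hup ⟨h12.1, h12.2, h3⟩

/-- **N10 AT THE B13-RE-BOUND STAGE-11 VIEW, TORUS PIN**: the run's pinned step data IS the record of a two-scale torus step `Wt` (`hS` — what
`CarriersB13` sets), Lemmas 1–2 hold for it (`h12` = `lemma12_twoTorus Wt c k …`), Lemma 3 is the FLAG `h3`. [cite: Balaban1988RG2Cluster, Lemma 1 p.9, Lemma 2 p.11, Lemma 3 p.20] -/
theorem b13_main_at_stage11_twoTorus
    (hup : w.up P = upOfRecord₅C F N ((θ.toStage5₁₁ F N).rebindX F N fun P => { θ.res.X P with S13 := S P, c13 := c }) P)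
    {L N' : ℕ} [NeZero L] [NeZero N'] (Wt : TwoTorusStep 4 L N') (hS : S P = Wt.toStepData)
    (h12 : B13.Lemma1Printed Wt.toStepData c ∧ B13.Lemma2Printed Wt.toStepData c) (h3 : B13.Lemma3Printed Wt.toStepData c) :
    Dag.B13_main (leavesP w P) :=
  b13_main_at_stage11_of_lemma12 F N θ S c w P hup (hS ▸ h12) (hS ▸ h3)

/-- … with Lemma 3 in the (2.38) currency (`B13LeafTorus.lemma3_conjunct_twoTorus`; on the torus (2.38) is `B13Lemma3Torus.bound238_torus` from the
(2.26)-majorant and numbers — NODE A). [cite: Balaban1988RG2Cluster, (2.38) p.20] -/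
theorem b13_main_at_stage11_twoTorus_of_238
    (hup : w.up P = upOfRecord₅C F N ((θ.toStage5₁₁ F N).rebindX F N fun P => { θ.res.X P with S13 := S P, c13 := c }) P)
    {L N' : ℕ} [NeZero L] [NeZero N'] (Wt : TwoTorusStep 4 L N') (hS : S P = Wt.toStepData)
    (h12 : B13.Lemma1Printed Wt.toStepData c ∧ B13.Lemma2Printed Wt.toStepData c) (h238 : B13.Bound238 Wt.toStepData c) :
    Dag.B13_main (leavesP w P) :=
  b13_main_at_stage11_twoTorus F N θ S c w P hup Wt hS h12 (B13LeafTorus.lemma3_conjunct_twoTorus Wt c h238)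

end N10

/-! ### The located knit: Lemmas 1–2 FROM THEIR LOCATED PER-TERM INPUTS (`B13NodeTorusTermwise.lemma12_twoTorus`), Lemma 3 the FLAG -/

section Located

open Metric
open Literature.MathematicalPhysics.QuantumFieldTheory.Balaban1983to89.B16Absorption (pbox)
open Literature.MathematicalPhysics.QuantumFieldTheory.Balaban1983to89.TreeLengthTorus
open Literature.MathematicalPhysics.QuantumFieldTheory.Balaban1983to89.TreeLengthTorusTransfer (tcoarse)
open Literature.MathematicalPhysics.QuantumFieldTheory.Balaban1983to89.B12TreeDecay (kappa₀ K₀)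
open Literature.MathematicalPhysics.QuantumFieldTheory.Balaban1983to89.B13PkScaling (Qop scaled)
open Literature.MathematicalPhysics.QuantumFieldTheory.Balaban1983to89.B13NodeTorusTermwise (lemma12_twoTorus)

variable (θ : Stage11Params F N) (S : B12.RunParams → B13.StepData) (c : B13.Consts) (w : WorldP) (P : B12.RunParams)

set_option maxSynthPendingDepth 3 in
/-- **N10 AT THE B13-RE-BOUND STAGE-11 VIEW — LEMMAS 1–2 KNIT FROM THEIR LOCATED INPUTS ON THE TWO-SCALE TORUS, LEMMA 3 THE LOCATED FLAG HYPOTHESIS.**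
The run's pinned step data IS the record of `Wt` (`hS`; L·N′ ≥ 12, L ≥ 2).  LEMMA 1 (pp. 7–9): the decomposition (1.33) with [I]'s block geometry concrete,
per-term analyticity, thresholds and R8∕R9, per-term (1.24)∕(1.30) BY REFERENCE to [I] (3.54), (3.17), [15] Prop. 4, [13] (3.108) (`h124`, `h130` — where
the in-edges' content enters), the choice `hC` of C₁, C₂, q with headroom `(1 − ϑ)`; LEMMA 2 (pp. 10–11): V″_k = V′_k + the local pieces `Gl` of P^{(k)},
the coordinate reading of B, per cube the scaled cubic `1/g_k²`-terms with the (1.38)∕(1.39) data, the identifications `hV`∕`hQ`, (1.34) in coordinates,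
the floor, gauge invariance by assertion (cell GAPS G-B13-06) — EXACTLY the binders of `B13NodeTorusTermwise.lemma12_twoTorus`, whose conclusion is applied
BY NAME; LEMMA 3 (p. 20, (2.38)) = `h3`, NODE A's content, displayed.  The numeric binders are jointly satisfiable with print's R12 «q ≧ 8»
(`B13ChainJointNonvacuity.chain_joint_nonvacuous`). [cite: Balaban1988RG2Cluster, Lemma 1 p.9, Lemma 2 p.11, Lemma 3 p.20] -/
theorem b13_main_at_stage11_twoTorus_located
    (hup : w.up P = upOfRecord₅C F N ((θ.toStage5₁₁ F N).rebindX F N fun P => { θ.res.X P with S13 := S P, c13 := c }) P)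
    {L N' : ℕ} [NeZero L] [NeZero N'] (Wt : TwoTorusStep 4 L N') (hS : S P = Wt.toStepData) (k : ℕ) (hN12 : 12 ≤ L * N') (hL2 : 2 ≤ L)
    -- (1) LEMMA 1: index data of (1.33)
    (S0 : TDom 4 (L * N') → Finset (TPt 4 (L * N')))
    (Fc : TDom 4 (L * N') → TPt 4 (L * N') → Finset (TPt 4 (L * N')))
    (Sq : TDom 4 (L * N') → TPt 4 (L * N') → (j : ℕ) → Finset (TPt 4 (L ^ (k - j) * (L * N'))))
    (SX : TDom 4 (L * N') → TPt 4 (L * N') → (j : ℕ) → TPt 4 (L ^ (k - j) * (L * N')) →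
      Finset (TDom 4 (L ^ (k - j) * (L * N'))))
    (T : TDom 4 (L * N') → TPt 4 (L * N') → Finset (TPt 4 (L * N')) → (j : ℕ) →
      TPt 4 (L ^ (k - j) * (L * N')) → TDom 4 (L ^ (k - j) * (L * N')) → Wt.Φ → ℂ)
    (Sc : TDom 4 (L * N') → Finset (TPt 4 (L * N')))
    (Sq' : TDom 4 (L * N') → TPt 4 (L * N') → (j : ℕ) → Finset (TPt 4 (L ^ (k - j) * (L * N'))))
    (SX' : TDom 4 (L * N') → TPt 4 (L * N') → (j : ℕ) → TPt 4 (L ^ (k - j) * (L * N')) →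
      Finset (TDom 4 (L ^ (k - j) * (L * N'))))
    (T' : TDom 4 (L * N') → TPt 4 (L * N') → (j : ℕ) → TPt 4 (L ^ (k - j) * (L * N')) →
      TDom 4 (L ^ (k - j) * (L * N')) → Wt.Φ → ℂ)
    (dist : TDom 4 (L * N') → TPt 4 (L * N') → (j : ℕ) → TPt 4 (L ^ (k - j) * (L * N')) → ℝ) {K K' : ℝ}
    (h133 : ∀ Y, Wt.Vp Y =
      (∑ a ∈ S0 Y, ∑ X ∈ (Fc Y a).powerset, ∑ j ∈ Finset.range (k + 1), ∑ q ∈ Sq Y a j,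
        ∑ x ∈ SX Y a j q, T Y a X j q x) +
      (∑ a ∈ Sc Y, ∑ j ∈ Finset.range (k + 1), ∑ q ∈ Sq' Y a j, ∑ x ∈ SX' Y a j q, T' Y a j q x))
    (hS0Y : ∀ Y, ∀ a ∈ S0 Y,
      (pbox (fun i => natLift a i - (5 : ℕ)) (fun i => natLift a i + 1 + (5 : ℕ))).image (proj (L * N')) ⊆ Y.1)
    (hFsub : ∀ Y a, Fc Y a ⊆
      (pbox (fun i => natLift a i - (5 : ℕ)) (fun i => natLift a i + 1 + (5 : ℕ))).image (proj (L * N')) \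
        (pbox (fun i => natLift a i - (4 : ℕ)) (fun i => natLift a i + 1 + (4 : ℕ))).image (proj (L * N')))
    (hSq : ∀ Y, ∀ a ∈ S0 Y, ∀ j, Sq Y a j ⊆ (Finset.univ : Finset (TPt 4 (L ^ (k - j) * (L * N')))).filter
      (fun q => tcoarse (L ^ (k - j)) (L * N') q ∈
        (pbox (fun i => natLift a i - (2 : ℕ)) (fun i => natLift a i + 1 + (2 : ℕ))).image (proj (L * N'))))
    (hScY : ∀ Y, Sc Y ⊆ Y.1)
    (hdist0 : ∀ Y a j q, 0 ≤ c.δ₀ * dist Y a j q)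
    (hdist : ∀ Y a j (n : ℕ) q, q ∉ (pbox (fun i => ((L ^ (k - j) : ℕ) : ℤ) * natLift a i - (n + 1 : ℕ))
      (fun i => ((L ^ (k - j) : ℕ) : ℤ) * natLift a i + 2 * ((L ^ (k - j) : ℕ) : ℤ) - 1 + (n + 1 : ℕ))).image
        (proj (L ^ (k - j) * (L * N'))) → c.δ₀ * c.M * ((n : ℝ) + 1) ≤ c.δ₀ * dist Y a j q)
    (hSX : ∀ Y a j q, SX Y a j q ⊆ (tcubeSys 4 (L ^ (k - j) * (L * N'))).above q)
    (hSX' : ∀ Y a j q, SX' Y a j q ⊆ (tcubeSys 4 (L ^ (k - j) * (L * N'))).above q)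
    (hX0 : ∀ Y, ∀ a ∈ Sc Y, ∀ j ∈ Finset.range (k + 1), ∀ q ∈ Sq' Y a j, ∀ x ∈ SX' Y a j q,
      x.1.image (tcoarse (L ^ (k - j)) (L * N')) ⊆ Y.1)
    -- (1) LEMMA 1: analyticity of the terms, closure of `Analytic`
    (hAdd : ∀ (s : Set Wt.Φ) (f g : Wt.Φ → ℂ), Wt.Analytic f s → Wt.Analytic g s → Wt.Analytic (f + g) s)
    (hZero : ∀ s : Set Wt.Φ, Wt.Analytic 0 s)
    (hAnT : ∀ Y, ∀ a ∈ S0 Y, ∀ X ∈ (Fc Y a).powerset, ∀ j ∈ Finset.range (k + 1), ∀ q ∈ Sq Y a j,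
      ∀ x ∈ SX Y a j q, Wt.Analytic (T Y a X j q x) (Wt.sp1 Y))
    (hAnT' : ∀ Y, ∀ a ∈ Sc Y, ∀ j ∈ Finset.range (k + 1), ∀ q ∈ Sq' Y a j, ∀ x ∈ SX' Y a j q,
      Wt.Analytic (T' Y a j q x) (Wt.sp1 Y))
    -- (1) LEMMA 1: thresholds and restrictions
    (hK : 0 ≤ K) (hK' : 0 ≤ K') (hκ : 0 ≤ c.κ) (hδ1 : c.δ < 1) (hδκ : 1 ≤ c.δ * c.κ)
    (hκ126 : kappa₀ 64 8 ≤ c.κ) (hκ126' : kappa₀ 64 8 ≤ c.δ * c.κ)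
    (hκ₁ : 1 + 2 * Real.log (8 * 12 ^ 3) ≤ c.κ₁) (hκ₁' : 2 + 16 * Real.log 128 ≤ c.κ₁)
    (hδ₀M : 10 * Real.exp (-1) ≤ c.δ₀ * c.M) (hδ₀M5 : 2 * Real.log 5 ≤ c.δ₀ * c.M)
    (hR8 : (1 - c.δ) * c.κ ≤ (1 / 4) * (c.κ₁ - 1)) (hR9 : (1 - 2 * c.δ) * c.κ ≤ (1 / 16) * c.κ₁)
    -- (1) LEMMA 1: per-term (1.24), (1.30) by reference to [I] (3.54), (3.17), [15] Prop. 4, [13] (3.108); the constants with headroom (1 − ϑ)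
    (h124 : ∀ Y φ, φ ∈ Wt.sp1 Y → ∀ a ∈ S0 Y, ∀ X ∈ (Fc Y a).powerset, ∀ j ∈ Finset.range (k + 1), ∀ q ∈ Sq Y a j,
      ∀ x ∈ SX Y a j q,
        ‖T Y a X j q x φ‖ ≤ K * ((L : ℝ) ^ j * ((L : ℝ) ^ k)⁻¹) ^ 5 *
          Real.exp (-(c.κ₁ - 1) *
            (((Y.1 \ (pbox (fun i => natLift a i - (5 : ℕ)) (fun i => natLift a i + 1 + (5 : ℕ))).image
              (proj (L * N'))).card : ℝ) + X.card)) *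
          Real.exp (-(c.κ * torusTreeLen x.1)))
    (h130 : ∀ Y φ, φ ∈ Wt.sp1 Y → ∀ a ∈ Sc Y, ∀ j ∈ Finset.range (k + 1), ∀ q ∈ Sq' Y a j,
      ∀ x ∈ SX' Y a j q,
        ‖T' Y a j q x φ‖ ≤ K' * Real.exp (-(1 / 2) * (c.δ₀ * c.M) * ((L : ℝ) ^ j * ((L : ℝ) ^ k)⁻¹)⁻¹
            - (1 / 2) * c.δ₀ * dist Y a j q) *
          Real.exp (-(c.κ₁ - 1) * ((Y.1 \ x.1.image (tcoarse (L ^ (k - j)) (L * N'))).card : ℝ)) *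
          Real.exp (-(c.κ * torusTreeLen x.1)))
    {ϑ : ℝ} (hϑ0 : 0 ≤ ϑ) (hϑ1 : ϑ < 1)
    (hC : K * K₀ 64 8 * (2 * (6 * (L : ℝ)) ^ 4) * Real.exp 1 * Real.exp ((1 / 8) * c.κ₁ * (12 ^ 4 - 1)) +
        2 * (64 * K') * K₀ 64 8 * 1344 ≤
      (1 - ϑ) * (c.E₀ * c.ε₁ * c.C₁ * c.M ^ c.q * Real.exp (c.C₂ * c.κ₁)))
    -- (2) LEMMA 2 (pp. 10–11): V″_k = V′_k + the local pieces of P^{(k)}; the located per-term data of `B13Lemma2Torus.lemma2Printed_twoTorus'`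
    (Gl : TDom 4 (L * N') → Wt.Φ → ℂ) (hVpp : ∀ Y, Wt.Vpp Y = fun φ => Wt.Vp Y φ + Gl Y φ)
    (hGlAn : ∀ Y, Wt.Analytic (Gl Y) (Wt.sp1 Y))
    (hGl : ∀ Y φ, φ ∈ Wt.sp1 Y → ‖Gl Y φ‖ ≤ ϑ * (c.E₀ * c.ε₁ * c.C₁ * c.M ^ c.q * Real.exp (c.C₂ * c.κ₁)) *
      Real.exp (-((1 - 2 * c.δ) * c.κ * (tsys 4 (L * N')).dj Y)))
    {E : Type*} [NormedAddCommGroup E] [NormedSpace ℂ E]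
    (rd : TDom 4 (L * N') → Wt.Φ → E) (e : TDom 4 (L * N') → Wt.Bond → E) (he : ∀ Y b, ‖e Y b‖ ≤ 1)
    (hrd : ∀ Y φ, rd Y φ = haveI := Wt.finBond; ∑ b, Wt.Bv φ b • e Y b)
    {ι₂ : Type*} (s : TDom 4 (L * N') → Finset ι₂) (Wf : TDom 4 (L * N') → ι₂ → Wt.Φ → E → ℂ) {g : ℂ} (hg : g ≠ 0)
    {R K₂ : ℝ} {m₂ : ℕ} (hK₂ : 0 ≤ K₂) (hR : 0 < R) (hε3 : 3 * c.ε₁ ≤ R)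
    (hW : ∀ Y, ∀ i ∈ s Y, ∀ φ ∈ Wt.sp1 Y, AnalyticOnNhd ℂ (Wf Y i φ) (ball 0 R))
    (hKW : ∀ Y, ∀ i ∈ s Y, ∀ φ ∈ Wt.sp1 Y, ∀ z ∈ ball (0 : E) R,
      ‖Wf Y i φ z‖ ≤ K₂ * Real.exp (-(c.κ₁ - 1) * ((Y.1.card : ℝ) - 1)) * ‖z‖ ^ 3)
    (hcard : ∀ Y, (s Y).card ≤ m₂ * Y.1.card)
    (hV : ∀ Y, Wt.V Y = fun φ => (∑ i ∈ s Y, scaled g (Wf Y i φ) (rd Y φ)) + Wt.Vpp Y φ)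
    (hQ : ∀ Y φ (b b' : Wt.Bond), φ ∈ Wt.sp1 Y →
      Wt.Q Y φ b b' = 2 * ∑ i ∈ s Y, Qop (scaled g (Wf Y i φ)) (rd Y φ) (e Y b) (e Y b'))
    (hsp : ∀ Y φ, φ ∈ Wt.sp1 Y → ‖g‖ * ‖rd Y φ‖ < c.ε₁)
    (hvolk : ∀ Y, Wt.volk Y = Y.1.card)
    (hfloor : 27 * m₂ * K₂ * Real.exp (c.κ₁ - 1) ≤ c.C₃ * c.M ^ 4 * Real.exp (c.C₂ * c.κ₁))
    (hAnP : ∀ Y, ∀ i ∈ s Y, Wt.Analytic (fun φ => scaled g (Wf Y i φ) (rd Y φ)) (Wt.sp1 Y))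
    (hG : ∀ Y, Wt.GaugeInv (Wt.V Y) ∧ Wt.GaugeInv (Wt.toStepData.quadForm Y) ∧ Wt.GaugeInv (Wt.Vpp Y))
    -- (3) LEMMA 3 (p. 20): THE LOCATED FLAG — NODE A's content, displayed
    (h3 : B13.Lemma3Printed Wt.toStepData c) :
    Dag.B13_main (leavesP w P) :=
  b13_main_at_stage11_twoTorus F N θ S c w P hup Wt hS
    (lemma12_twoTorus Wt c k hN12 hL2 S0 Fc Sq SX T Sc Sq' SX' T' dist h133 hS0Y hFsub hSq hScY hdist0 hdist hSX hSX' hX0 hAdd hZero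
      hAnT hAnT' hK hK' hκ hδ1 hδκ hκ126 hκ126' hκ₁ hκ₁' hδ₀M hδ₀M5 hR8 hR9 h124 h130 hϑ0 hϑ1 hC Gl hVpp hGlAn hGl rd e he hrd s Wf
      hg hK₂ hR hε3 hW hKW hcard hV hQ hsp hvolk hfloor hAnP hG)
    h3

end Located

section Record

variable {F N}

/-- **K1-FACING ∃-FORM AT THE RECORD.**  From a Stage-11 record `(D, w)` and, for the record's parameters `θ`, pinned step data `S θ P` with ONE constants
record `c θ` carrying Lemmas 1–2 (`h12`) and the Lemma-3 FLAG (`h3`) at every run: the B13-re-bound world `w′` is a Stage-11 record WITH THE SAME DATUM,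
construction, interval letter and block size, its 22-leaf assignment at every run is `w`'s with `b13 :=` the triple, and N10 `Dag.B13_main` holds at
every run of `w′` (the other nodes' statements transfer along `leavesP_rebindS13_eq`; the count moves only when `S` is NODE 00's object of record and
`h12`∕`h3` are theorems about it). [cite: Balaban1988RG2Cluster, Lemmas 1–3 pp.9, 11, 20; Balaban1989LargeFieldII, Thm 1 + (0.1) pp.355–356 (the record)] -/
theorem exists_b13World_of_isRecordOfRecord₁₁C {D : FiniteEpsData F (SU N)} {w : WorldP} (hR : IsRecordOfRecord₁₁C F N D w)
    (S : Stage11Params F N → B12.RunParams → B13.StepData) (c : Stage11Params F N → B13.Consts)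
    (h12 : ∀ θ : Stage11Params F N, θ.Provisos₁₁ → θ.Admissible → ∀ P,
      B13.Lemma1Printed (S θ P) (c θ) ∧ B13.Lemma2Printed (S θ P) (c θ))
    (h3 : ∀ θ : Stage11Params F N, θ.Provisos₁₁ → θ.Admissible → ∀ P, B13.Lemma3Printed (S θ P) (c θ)) :
    ∃ (θ : Stage11Params F N) (w' : WorldP), θ.Provisos₁₁ ∧ θ.Admissible ∧ (∀ P, w.up P = upOfRecord₅C F N (θ.toStage5₁₁ F N) P) ∧
      IsRecordOfRecord₁₁C F N D w' ∧ w'.C = w.C ∧ w'.γ = w.γ ∧ w'.L = w.L ∧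
      (∀ P, leavesP w' P =
        { leavesP w P with b13 := B13.Lemma1Printed (S θ P) (c θ) ∧ B13.Lemma2Printed (S θ P) (c θ) ∧ B13.Lemma3Printed (S θ P) (c θ) }) ∧
      ∀ P, Dag.B13_main (leavesP w' P) := by
  obtain ⟨θ, hP, hθ, hD, hup, hR'⟩ :=
    exists_rebindX_of_isRecordOfRecord₁₁C hR fun θ P => { θ.res.X P with S13 := S θ P, c13 := c θ }
  refine ⟨θ, _, hP, hθ, hup, hR', rfl, rfl, rfl, fun P => ?_, fun P => ?_⟩
  · exact leavesP_rebindS13_eq F N (θ.toStage5₁₁ F N) (S θ) (c θ) P w hup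
  · exact b13_main_at_stage11_of_lemma12 F N θ (S θ) (c θ) _ P rfl (h12 θ hP hθ P) (h3 θ hP hθ P)

end Record

/-! ## §4. The route stub shape `YMDAG.UVSplit.S_N10 Rec` at record predicates bound at a B13-re-bound Stage-11 view -/

section Stub

variable {F N}

/-- **`S_N10 Rec` FOR EVERY RECORD PREDICATE WHOSE WORLDS ARE BOUND AT A B13-RE-BOUND STAGE-11 VIEW CARRYING THE TRIPLE** — the shape NODE 00's
`CarriersB13` record (`S :=` the two-scale torus step data of record, triple from the torus chain + NODE A) instantiates; here the pin, Lemmas 1–2 and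
the Lemma-3 FLAG are what `Rec` is assumed to certify. [cite: Balaban1988RG2Cluster, Lemmas 1–3 pp.9, 11, 20] -/
theorem s_N10_of_boundAtRebindS13 (Rec : RecordPred N)
    (hRec : ∀ (F : T4Family) (D : FiniteEpsData F (SU N)) (w : WorldP), Rec F D w →
      ∃ (θ : Stage11Params F N) (S : B12.RunParams → B13.StepData) (c : B13.Consts),
        (∀ P, w.up P = upOfRecord₅C F N ((θ.toStage5₁₁ F N).rebindX F N fun P => { θ.res.X P with S13 := S P, c13 := c }) P) ∧
          ∀ P, B13.Lemma1Printed (S P) c ∧ B13.Lemma2Printed (S P) c ∧ B13.Lemma3Printed (S P) c) :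
    S_N10 Rec := by
  intro F D w hw P
  obtain ⟨θ, S, c, hup, hleaf⟩ := hRec F D w hw
  exact b13_main_at_stage11_rebindS13 F N θ S c w P (hup P) (hleaf P)

end Stub

end Summit.QuantumFields.YangMills.BalabanUVNodes.N10AtRecord11

end
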